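import Literature.NumberTheory.DiophantineApproximation.PolylogShiftHermitePade
import Literature.NumberTheory.DiophantineApproximation.DilogHermitePadeSeries
import Literature.NumberTheory.DiophantineApproximation.PolylogShiftFourBridge
import HarnessLib

/-!
# The `m`-shift Hermite–Padé form at `y = 1/M` as `∑_{o<w} ∑_{r<m} a_{o,r} Φ_{o+1,r+1}(1/M) + a`

Topic `Literature/NumberTheory/DiophantineApproximation`. For the `m`-shift form
`Λ^{(m,w)}_n(y) = ∑_{u ≥ 0} K^{(m,w)}_n(u) y^{u+1}` of `PolylogShiftHermitePade.lean`
(`ShiftPade.formM`), a partial fraction expansion of the kernel at the naturals in the variable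
`t = mu`, `K^{(m,w)}_n(u) = ∑_{p ≤ n} ∑_{o<w} c_{o,p}/(mu+p+1)^{o+1}` (`BallRivoal.pfEval n w c (mu)`;
proved to exist in the sibling Expansion file, here it is the HYPOTHESIS `hc`), turns `Λ^{(m,w)}_n(1/M)`
into `∑_{o<w} ∑_{r<m} a_{o,r} Φ_{o+1,r+1}(1/M) + a`, where
`Φ_{s,r}(y) = ∑_{k ≥ 0} y^{k+1}/(mk+r)^s` (`ShiftPade.lerchShift m r s y`),
`a_{o,r} = coefM n m c M o (r+1)` (the pole indices `p` with `p % m = r`) and `a = constShift n m w c M`.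

* `summable_pow_div_shiftM` (and `summable_lerchShift_terms` of `PolylogShiftFourBridge.lean`) — the series `∑_u y^{u+1}/(m(u+i)+r)^s`
  converge for `0 ≤ y < 1`, `r ≥ 1` (comparison with the geometric series);
* `pow_mul_tsum_shiftM` — `y^i ∑_{u ≥ 0} y^{u+1}/(m(u+i)+r)^s = Φ_{s,r}(y) − ∑_{k<i} y^{k+1}/(mk+r)^s`;
* `formM_eq_of_pfEval` — `Λ^{(m,w)}_n(1/M) = ∑_{o<w} ∑_{r<m} (coefM n m c M o (r+1)) Φ_{o+1,r+1}(1/M)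
  + constShift n m w c M` for `M ≥ 2`, `m ≥ 1` (the `m`-shift analogue of `ParityPade.formH_eq_of_pfEval`
  and `PolylogPade.formW_eq_of_pfEval`).

The computation, per pole index `p ≤ n` and order `s = o + 1`: writing `p = m·(p/m) + p % m`
(natural division), `i = p/m`, `r = p % m + 1 ≥ 1`, the denominator is `mu + p + 1 = m(u + i) + r`, so
`∑_u y^{u+1}/(mu+p+1)^s = M^i (Φ_{s,r}(y) − ∑_{k<i} y^{k+1}/(mk+r)^s)` at `y = 1/M`
(`pow_mul_tsum_shiftM`, `y^i M^i = 1`); in the finite remainder `M^i y^{k+1} = M^i/M^{k+1}`, and the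
`Φ`-part is regrouped by the residue `r − 1 = p % m < m` of the pole index.

References: S. David, N. Hirata-Kohno, M. Kawashima, *Can polylogarithms at algebraic points be
linearly independent?*, Moscow J. Comb. Number Th. 9 (2020), Thm 2.1; S. David, N. Hirata-Kohno,
M. Kawashima, *Linear independence criteria for generalized polylogarithms with distinct shifts*,
arXiv:2010.09167; M. Hata, J. Math. Pures Appl. 69 (1990); E. M. Nikišin, Mat. Sb. 109 (1979).
Everything here is PROVED from Mathlib's `tsum` API; no definitions, no named facts.
-/

noncomputable section

open Finset

namespace Literature.NumberTheory.DiophantineApproximation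

namespace ShiftPade

open Literature.NumberTheory.Transcendental

/-- Summability of the `m`-shifted series `∑_u y^{u+1}/(m(u+i)+r)^s` for `0 ≤ y < 1` and `r ≥ 1`:
its terms are nonnegative and at most `y^{u+1}` (the denominators are `≥ r ≥ 1`), so it is dominated
by the geometric series. [folklore] -/
theorem summable_pow_div_shiftM (m r s i : ℕ) (hr : 1 ≤ r) {y : ℝ} (hy : 0 ≤ y) (hy1 : y < 1) :
    Summable fun u : ℕ => y ^ (u + 1) / ((m : ℝ) * ((u : ℝ) + i) + r) ^ s := by
  refine Summable.of_nonneg_of_le (fun u => by positivity) (fun u => ?_)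
    ((summable_geometric_of_lt_one hy hy1).mul_left y)
  rw [← pow_succ']
  exact div_le_self (pow_nonneg hy _)
    (one_le_pow₀ (le_add_of_nonneg_of_le (by positivity) (by exact_mod_cast hr)))

/-- The `m`-shifted series: for `0 ≤ y < 1`, `r ≥ 1` and `i, s ∈ ℕ`,
`y^i · ∑_{u ≥ 0} y^{u+1}/(m(u+i)+r)^s = Φ_{s,r}(y) − ∑_{k<i} y^{k+1}/(mk+r)^s`
(reindex `k = u + i` in `Φ_{s,r}(y) = ∑_{k ≥ 0} y^{k+1}/(mk+r)^s`). [folklore] -/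
theorem pow_mul_tsum_shiftM (m r s i : ℕ) (hr : 1 ≤ r) {y : ℝ} (hy : 0 ≤ y) (hy1 : y < 1) :
    y ^ i * ∑' u : ℕ, y ^ (u + 1) / ((m : ℝ) * ((u : ℝ) + i) + r) ^ s =
      lerchShift m r s y - ∑ k ∈ Finset.range i, y ^ (k + 1) / ((m : ℝ) * k + r) ^ s := by
  rw [lerchShift, ← (summable_lerchShift_terms m r s hr hy hy1).sum_add_tsum_nat_add i,
    add_sub_cancel_left, ← tsum_mul_left]
  refine tsum_congr fun u => ?_
  push_cast
  ring

/-- **The `m`-shift Hermite–Padé form at `y = 1/M`** (David–Hirata-Kohno–Kawashima 2020, the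
computation behind Thm 2.1 with the shifts `r/m`; Hata 1990; Nikišin 1979). If the `m`-shift kernel
has the partial fraction expansion `K^{(m,w)}_n(u) = ∑_{p ≤ n} ∑_{o<w} c_{o,p}/(mu+p+1)^{o+1}` at the
naturals `u` (`BallRivoal.pfEval n w c (mu)`), then for every integer `M ≥ 2`
`Λ^{(m,w)}_n(1/M) = ∑_{o<w} ∑_{r<m} (coefM n m c M o (r+1)) · Φ_{o+1,r+1}(1/M) + constShift n m w c M`:
the pole index `p` feeds the shift `r + 1 = p % m + 1`, since `mu + p + 1 = m(u + p/m) + (p % m + 1)`.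
[cite: DavidHirataKohnoKawashima2020, Thm 2.1] -/
theorem formM_eq_of_pfEval {m w n M : ℕ} (hm : 1 ≤ m) (hM : 2 ≤ M) (c : ℕ → ℕ → ℚ)
    (hc : ∀ u : ℕ, kernelM m w n u = BallRivoal.pfEval n w c (m * u)) :
    formM m w n (1 / (M : ℝ)) =
      (∑ o ∈ Finset.range w, ∑ r ∈ Finset.range m,
          ((coefM n m c M o (r + 1) : ℚ) : ℝ) * lerchShift m (r + 1) (o + 1) (1 / (M : ℝ))) +
        ((constShift n m w c M : ℚ) : ℝ) := by
  have hMpos : (0 : ℝ) < M := Nat.cast_pos.mpr (by omega)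
  have hM0 : (M : ℝ) ≠ 0 := hMpos.ne'
  set y : ℝ := 1 / (M : ℝ) with hy
  have hy0 : 0 ≤ y := by positivity
  have hy1 : y < 1 := by
    rw [hy, div_lt_one hMpos]
    exact_mod_cast (by omega : 1 < M)
  have hMy : ∀ j : ℕ, (M : ℝ) ^ j * y ^ j = 1 := fun j => by
    rw [← mul_pow, hy, mul_one_div_cancel hM0, one_pow]
  -- summability of the general term `y^{u+1}/(mu+p+1)^s` (comparison with the geometric series)
  have hS : ∀ s p : ℕ, Summable fun u : ℕ => y ^ (u + 1) / ((m : ℝ) * (u : ℝ) + p + 1) ^ s := by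
    intro s p
    refine Summable.of_nonneg_of_le (fun u => by positivity) (fun u => ?_)
      ((summable_geometric_of_lt_one hy0 hy1).mul_left y)
    rw [← pow_succ']
    exact div_le_self (pow_nonneg hy0 _) (one_le_pow₀ (le_add_of_nonneg_left (by positivity)))
  -- the shift identity at `y = 1/M` for the pole index `p`, solved for the shifted series:
  -- `mu + p + 1 = m(u + i) + r` with `i = p / m`, `r = p % m + 1`.
  have hg : ∀ s p : ℕ,
      ∑' u : ℕ, y ^ (u + 1) / ((m : ℝ) * (u : ℝ) + p + 1) ^ s =
        (M : ℝ) ^ (p / m) * (lerchShift m (p % m + 1) s y -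
          ∑ k ∈ range (p / m), y ^ (k + 1) / ((m : ℝ) * k + ((p % m + 1 : ℕ) : ℝ)) ^ s) := by
    intro s p
    rw [← pow_mul_tsum_shiftM m (p % m + 1) s (p / m) (Nat.succ_pos _) hy0 hy1, ← mul_assoc, hMy,
      one_mul]
    refine tsum_congr fun u => ?_
    have hp : (p : ℝ) = (m : ℝ) * ((p / m : ℕ) : ℝ) + ((p % m : ℕ) : ℝ) := by
      exact_mod_cast (Nat.div_add_mod p m).symm
    rw [hp]
    push_cast
    ring
  -- Step 1: expand the kernel by `hc` (cast from `ℚ` to `ℝ`) and exchange `tsum` and finite sums.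
  have hterm : ∀ u : ℕ, (kernelM m w n u : ℝ) * y ^ (u + 1) =
      ∑ p ∈ range (n + 1), ∑ o ∈ range w,
        (c o p : ℝ) * (y ^ (u + 1) / ((m : ℝ) * (u : ℝ) + p + 1) ^ (o + 1)) := by
    intro u
    have hcu : (kernelM m w n u : ℝ) =
        ∑ p ∈ range (n + 1), ∑ o ∈ range w, (c o p : ℝ) / ((m : ℝ) * (u : ℝ) + p + 1) ^ (o + 1) := by
      rw [hc u]
      push_cast [BallRivoal.pfEval]
      rfl
    rw [hcu, Finset.sum_mul]
    refine Finset.sum_congr rfl fun p _ => ?_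
    rw [Finset.sum_mul]
    refine Finset.sum_congr rfl fun o _ => ?_
    ring
  have h1 : formM m w n y = ∑ p ∈ range (n + 1), ∑ o ∈ range w,
      (c o p : ℝ) * ∑' u : ℕ, y ^ (u + 1) / ((m : ℝ) * (u : ℝ) + p + 1) ^ (o + 1) := by
    rw [formM, tsum_congr hterm, Summable.tsum_finsetSum fun p _ =>
      summable_sum fun o _ => (hS (o + 1) p).mul_left (c o p : ℝ)]
    refine Finset.sum_congr rfl fun p _ => ?_
    rw [Summable.tsum_finsetSum fun o _ => (hS (o + 1) p).mul_left (c o p : ℝ)]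
    refine Finset.sum_congr rfl fun o _ => ?_
    exact tsum_mul_left
  -- Step 2: per pole index `p` and order `o + 1`, insert the shift identity and evaluate the
  -- finite remainder at `y = 1/M` (`M^i y^{k+1} = M^i/M^{k+1}`, `i = p/m`).
  have h2 : formM m w n y = ∑ p ∈ range (n + 1), ∑ o ∈ range w,
      (((c o p * (M : ℚ) ^ (p / m) : ℚ) : ℝ) * lerchShift m (p % m + 1) (o + 1) y -
        ((c o p * ∑ k ∈ range (p / m), (M : ℚ) ^ (p / m) /
            ((M : ℚ) ^ (k + 1) * ((m : ℚ) * k + ((p % m + 1 : ℕ) : ℚ)) ^ (o + 1)) : ℚ) : ℝ)) := by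
    rw [h1]
    refine Finset.sum_congr rfl fun p _ => ?_
    refine Finset.sum_congr rfl fun o _ => ?_
    have hfin : (M : ℝ) ^ (p / m) *
        ∑ k ∈ range (p / m), y ^ (k + 1) / ((m : ℝ) * k + (((p % m : ℕ) : ℝ) + 1)) ^ (o + 1) =
        ∑ k ∈ range (p / m), (M : ℝ) ^ (p / m) /
          ((M : ℝ) ^ (k + 1) * ((m : ℝ) * k + (((p % m : ℕ) : ℝ) + 1)) ^ (o + 1)) := by
      rw [Finset.mul_sum]
      refine Finset.sum_congr rfl fun k _ => ?_
      rw [hy, one_div_pow, div_div, mul_one_div]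
    rw [hg (o + 1) p]
    push_cast
    rw [← hfin]
    ring
  -- Step 3: regroup the pole indices `p` by their residues `r = p % m` and identify the coefficients.
  have hA : ∀ o : ℕ,
      ∑ r ∈ range m, ((coefM n m c M o (r + 1) : ℚ) : ℝ) * lerchShift m (r + 1) (o + 1) y =
        ∑ p ∈ range (n + 1),
          ((c o p * (M : ℚ) ^ (p / m) : ℚ) : ℝ) * lerchShift m (p % m + 1) (o + 1) y := by
    intro o
    have hco : ∀ r : ℕ, ((coefM n m c M o (r + 1) : ℚ) : ℝ) * lerchShift m (r + 1) (o + 1) y =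
        ∑ p ∈ range (n + 1), if p % m = r then
          ((c o p * (M : ℚ) ^ (p / m) : ℚ) : ℝ) * lerchShift m (r + 1) (o + 1) y else 0 := by
      intro r
      rw [coefM, Rat.cast_sum, Finset.sum_mul]
      refine Finset.sum_congr rfl fun p _ => ?_
      by_cases hpr : p % m = r
      · rw [if_pos (by omega), if_pos hpr]
      · rw [if_neg (by omega), if_neg hpr, Rat.cast_zero, zero_mul]
    simp_rw [hco]
    rw [Finset.sum_comm]
    refine Finset.sum_congr rfl fun p _ => ?_
    rw [Finset.sum_ite_eq (range m) (p % m), if_pos (Finset.mem_range.mpr (Nat.mod_lt p hm))]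
  have hC : ((constShift n m w c M : ℚ) : ℝ) = -∑ o ∈ range w, ∑ p ∈ range (n + 1),
      ((c o p * ∑ k ∈ range (p / m), (M : ℚ) ^ (p / m) /
          ((M : ℚ) ^ (k + 1) * ((m : ℚ) * k + ((p % m + 1 : ℕ) : ℚ)) ^ (o + 1)) : ℚ) : ℝ) := by
    simp only [constShift, Rat.cast_neg, Rat.cast_sum]
  rw [h2, Finset.sum_comm]
  simp only [Finset.sum_sub_distrib]
  simp_rw [← hA]
  rw [hC]
  ring

end ShiftPade

end Literature.NumberTheory.DiophantineApproximation
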